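import Literature.AlgebraicGeometry.Resolution.RegularLocalRingsQuotient
import HarnessLib

/-!
# Crux `EquisingularLift` (stmt-ResolutionOfSingularities-15660), line `Sketch`:
# stub `stub_linkedNode_regular` (linked complete-intersection node)

[OURS · L1 W4.5b] Move-set stub 1 of the registered skeleton `Cruxes/EquisingularLift/Lines/Sketch.lean`
(idea card `linked-ci-centres`, lemma 2); NOT a statement of any manuscript.

**Statement.** Let `(R, 𝔪)` be a regular local ring, `u` a unit, `ϖ, f, x, y ∈ 𝔪` with `f ∉ 𝔪²`,
`ϖ ∉ 𝔪² + (f)` and `x, y ∉ (f, ϖ)`. Then `R/(f, xy + ϖu)` is a regular local ring with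
`dim R/(f, xy + ϖu) + 2 = dim R`, and `ϖ ∉ (f, xy + ϖu)`.

**Proof.** `R₁ := R/(f)` is regular local of dimension `dim R - 1` (Matsumura 14.2, tree lemma
`IsRegularLocalRing.quotient_span_singleton`), and for `a : R` the image `ā ∈ R₁` lies in `𝔪₁²` iff
`a ∈ 𝔪² + (f)`. The element `g := xy + ϖu` lies in `𝔪`, and `g ∉ 𝔪² + (f)` (otherwise
`ϖu ∈ 𝔪² + (f)`, hence `ϖ ∈ 𝔪² + (f)`), so `ḡ ∈ 𝔪₁ ∖ 𝔪₁²` and `R₁/(ḡ) ≅ R/(f, g)` is regular local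
of dimension `dim R - 2` (third isomorphism theorem, `DoubleQuot.quotQuotEquivQuotSup`). For the last clause, `ϖ̄ ∈ 𝔪₁ ∖ 𝔪₁²` is a prime element of the domain `R₁`
(Matsumura 14.3); if `ϖ = af + bg` then `ϖ̄ = b̄ḡ = b̄(x̄ȳ + ϖ̄ū)`, so `ϖ̄ ∣ b̄x̄ȳ`; `ϖ̄ ∤ x̄` and
`ϖ̄ ∤ ȳ` because `x, y ∉ (f, ϖ)`, hence `b̄ = ϖ̄c̄` and `ϖ̄(1 - c̄ḡ) = 0`, making `ḡ ∈ 𝔪₁` a unit —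
absurd.
-/

set_option linter.dupNamespace false -- mandated namespace `Summit.<Summit>.<Problem>` of this single-conjunct summit

namespace Summit.ResolutionOfSingularities.ResolutionOfSingularities.Cruxes.EquisingularLift.StrataSplit

open IsLocalRing Literature.AlgebraicGeometry.Resolution

universe u

variable {R : Type u} [CommRing R]

/-- For a local ring `R`, an ideal `I` with `R ⧸ I` local and `a : R`: the image of `a` lies in the
maximal ideal of `R ⧸ I` iff `a ∈ 𝔪 ⊔ I`. [folklore] -/
theorem mk_mem_maximalIdeal_quotient_iff [IsLocalRing R] (I : Ideal R) [IsLocalRing (R ⧸ I)]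
    (a : R) : Ideal.Quotient.mk I a ∈ maximalIdeal (R ⧸ I) ↔ a ∈ maximalIdeal R ⊔ I := by
  rw [maximalIdeal_quotient_eq_map I, ← Ideal.mem_comap,
    Ideal.comap_map_of_surjective _ Ideal.Quotient.mk_surjective, ← RingHom.ker_eq_comap_bot,
    Ideal.mk_ker]

/-- For a local ring `R`, an ideal `I` with `R ⧸ I` local and `a : R`: the image of `a` lies in the
square of the maximal ideal of `R ⧸ I` iff `a ∈ 𝔪² ⊔ I`. [folklore] -/
theorem mk_mem_sq_maximalIdeal_quotient_iff [IsLocalRing R] (I : Ideal R) [IsLocalRing (R ⧸ I)]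
    (a : R) :
    Ideal.Quotient.mk I a ∈ maximalIdeal (R ⧸ I) ^ 2 ↔ a ∈ maximalIdeal R ^ 2 ⊔ I := by
  rw [maximalIdeal_quotient_eq_map I, ← Ideal.map_pow, ← Ideal.mem_comap,
    Ideal.comap_map_of_surjective _ Ideal.Quotient.mk_surjective, ← RingHom.ker_eq_comap_bot,
    Ideal.mk_ker]

/-- The image of `a` in `R ⧸ (f)` lies in the principal ideal generated by the image of `b` iff
`a ∈ (f, b)`. [folklore] -/
theorem mk_mem_span_singleton_mk_iff (f a b : R) :
    Ideal.Quotient.mk (Ideal.span {f}) a ∈ Ideal.span {Ideal.Quotient.mk (Ideal.span {f}) b} ↔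
      a ∈ Ideal.span {f, b} := by
  rw [← Set.image_singleton, ← Ideal.map_span, ← Ideal.mem_comap,
    Ideal.comap_map_of_surjective _ Ideal.Quotient.mk_surjective, ← RingHom.ker_eq_comap_bot,
    Ideal.mk_ker, Ideal.span_insert, sup_comm]

/-- **Two-step Matsumura 14.2.** In a regular local ring `(R, 𝔪)`, if `f ∈ 𝔪 ∖ 𝔪²` and
`g ∈ 𝔪 ∖ (𝔪² + (f))`, then `R/(f, g)` is regular local and `dim R/(f, g) + 2 = dim R`.
[cite: Matsumura1987, Thm. 14.2] -/
theorem isRegularLocalRing_quotient_span_pair [IsRegularLocalRing R] {f g : R}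
    (hf : f ∈ maximalIdeal R) (hf2 : f ∉ maximalIdeal R ^ 2) (hg : g ∈ maximalIdeal R)
    (hg2 : g ∉ maximalIdeal R ^ 2 ⊔ Ideal.span {f}) :
    IsRegularLocalRing (R ⧸ Ideal.span {f, g}) ∧
      ringKrullDim (R ⧸ Ideal.span {f, g}) + 2 = ringKrullDim R := by
  obtain ⟨h1, hdim1⟩ := IsRegularLocalRing.quotient_span_singleton hf hf2
  have hg1 : Ideal.Quotient.mk (Ideal.span {f}) g ∈ maximalIdeal (R ⧸ Ideal.span {f}) :=
    (mk_mem_maximalIdeal_quotient_iff _ g).mpr (Ideal.mem_sup_left hg)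
  have hg1' : Ideal.Quotient.mk (Ideal.span {f}) g ∉ maximalIdeal (R ⧸ Ideal.span {f}) ^ 2 := by
    rwa [mk_mem_sq_maximalIdeal_quotient_iff]
  obtain ⟨h2, hdim2⟩ := IsRegularLocalRing.quotient_span_singleton hg1 hg1'
  -- third isomorphism theorem: `(R ⧸ (f)) ⧸ (ḡ) ≃+* R ⧸ (f, g)`
  let e : (R ⧸ Ideal.span {f}) ⧸ Ideal.span {Ideal.Quotient.mk (Ideal.span {f}) g} ≃+*
      R ⧸ Ideal.span {f, g} :=
    (Ideal.quotEquivOfEq (by rw [Ideal.map_span, Set.image_singleton])).trans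
      ((DoubleQuot.quotQuotEquivQuotSup (Ideal.span {f}) (Ideal.span {g})).trans
        (Ideal.quotEquivOfEq (Ideal.span_insert f {g}).symm))
  refine ⟨IsRegularLocalRing.of_ringEquiv e, ?_⟩
  rw [← ringKrullDim_eq_of_ringEquiv e, ← hdim1, ← hdim2, add_assoc, one_add_one_eq_two]

/-- **The uniformizer survives a linked node.** In a regular local ring `(R, 𝔪)` let `f ∈ 𝔪 ∖ 𝔪²`,
`ϖ ∈ 𝔪 ∖ (𝔪² + (f))`, `x ∈ 𝔪` and `x, y ∉ (f, ϖ)`; then `ϖ ∉ (f, xy + ϖu)` for every `u`.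
[folklore] -/
theorem not_mem_span_pair_linkedNode [IsRegularLocalRing R] {ϖ f x y : R} (u : R)
    (hf : f ∈ maximalIdeal R) (hf2 : f ∉ maximalIdeal R ^ 2) (hϖ : ϖ ∈ maximalIdeal R)
    (hϖ2 : ϖ ∉ maximalIdeal R ^ 2 ⊔ Ideal.span {f}) (hx : x ∈ maximalIdeal R)
    (hxf : x ∉ Ideal.span {f, ϖ}) (hyf : y ∉ Ideal.span {f, ϖ}) :
    ϖ ∉ Ideal.span {f, x * y + ϖ * u} := by
  intro h
  obtain ⟨a, b, hab⟩ := Ideal.mem_span_pair.mp h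
  obtain ⟨h1, -⟩ := IsRegularLocalRing.quotient_span_singleton hf hf2
  haveI := isDomain_of_isRegularLocalRing (R ⧸ Ideal.span {f})
  -- notation for the images in `R₁ := R ⧸ (f)`
  set mk := Ideal.Quotient.mk (Ideal.span {f}) with hmk
  have hϖ1 : mk ϖ ∈ maximalIdeal (R ⧸ Ideal.span {f}) :=
    (mk_mem_maximalIdeal_quotient_iff _ ϖ).mpr (Ideal.mem_sup_left hϖ)
  have hϖ1' : mk ϖ ∉ maximalIdeal (R ⧸ Ideal.span {f}) ^ 2 := by
    rwa [hmk, mk_mem_sq_maximalIdeal_quotient_iff]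
  have hprime : Prime (mk ϖ) := IsRegularLocalRing.prime_of_not_mem_sq hϖ1 hϖ1'
  have hg1 : mk (x * y + ϖ * u) ∈ maximalIdeal (R ⧸ Ideal.span {f}) :=
    (mk_mem_maximalIdeal_quotient_iff _ _).mpr
      (Ideal.mem_sup_left (Ideal.add_mem _ (Ideal.mul_mem_right y _ hx)
        (Ideal.mul_mem_right u _ hϖ)))
  have hf0 : mk f = 0 := Ideal.Quotient.eq_zero_iff_mem.mpr (Ideal.mem_span_singleton_self f)
  -- `ϖ̄ = b̄ ḡ` in `R₁`
  have hab1 : mk b * mk (x * y + ϖ * u) = mk ϖ := by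
    have := congrArg mk hab
    simpa [map_add, map_mul, hf0] using this
  -- hence `ϖ̄ ∣ b̄ x̄ ȳ`
  have hdvd : mk ϖ ∣ mk b * mk x * mk y := by
    refine ⟨1 - mk b * mk u, ?_⟩
    have e : mk b * mk (x * y + ϖ * u) = mk b * mk x * mk y + mk ϖ * (mk b * mk u) := by
      simp only [map_add, map_mul]; ring
    linear_combination -e + hab1
  rcases hprime.dvd_or_dvd hdvd with hbx | hy'
  · rcases hprime.dvd_or_dvd hbx with hb | hx'
    · -- `b̄ = ϖ̄ c̄`: then `ϖ̄ (1 - c̄ ḡ) = 0`, so `ḡ` is a unit of `R₁`, absurd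
      obtain ⟨c, hc⟩ := hb
      have hzero : mk ϖ * (1 - c * mk (x * y + ϖ * u)) = 0 := by
        linear_combination (-1 : R ⧸ Ideal.span {f}) * hab1 + mk (x * y + ϖ * u) * hc
      rcases mul_eq_zero.mp hzero with h0 | h0
      · exact hprime.ne_zero h0
      · have hunit : IsUnit (mk (x * y + ϖ * u)) :=
          IsUnit.of_mul_eq_one c (by linear_combination (-1 : R ⧸ Ideal.span {f}) * h0)
        exact (IsLocalRing.mem_maximalIdeal _).mp hg1 hunit
    · exact hxf ((mk_mem_span_singleton_mk_iff f x ϖ).mp (Ideal.mem_span_singleton.mpr hx'))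
  · exact hyf ((mk_mem_span_singleton_mk_iff f y ϖ).mp (Ideal.mem_span_singleton.mpr hy'))

/-- **STUB `stub_linkedNode_regular`** (linked-CI node; registered stub of the line `Sketch` for the
crux `EquisingularLift`, stmt-ResolutionOfSingularities-15660). In a regular local ring `R` let
`f ∈ 𝔪 ∖ 𝔪²`, `ϖ ∈ 𝔪` with `ϖ ∉ 𝔪² + (f)`, `x, y ∈ 𝔪` both outside `(f, ϖ)`, and `u` a unit. Then
`R/(f, xy + ϖu)` is a regular local ring of dimension `dim R - 2` on which `ϖ` is non-zero (the total
space `{xy = ϖ}`-type node of a linked centre is regular and `O`-flat). [OURS · L1 W4.5b]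
[cite: Matsumura1987, Thm. 14.2, Thm. 14.3] -/
theorem stub_linkedNode_regular : ∀ (R : Type) [CommRing R] [IsRegularLocalRing R] (ϖ f x y u : R), IsUnit u → ϖ ∈ IsLocalRing.maximalIdeal R → f ∈ IsLocalRing.maximalIdeal R → f ∉ IsLocalRing.maximalIdeal R ^ 2 → x ∈ IsLocalRing.maximalIdeal R → y ∈ IsLocalRing.maximalIdeal R → ϖ ∉ IsLocalRing.maximalIdeal R ^ 2 ⊔ Ideal.span {f} → x ∉ Ideal.span {f, ϖ} → y ∉ Ideal.span {f, ϖ} → IsRegularLocalRing (R ⧸ Ideal.span {f, x * y + ϖ * u}) ∧ ringKrullDim (R ⧸ Ideal.span {f, x * y + ϖ * u}) + 2 = ringKrullDim R ∧ ϖ ∉ Ideal.span {f, x * y + ϖ * u} := by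
  intro R _ _ ϖ f x y u hu hϖ hf hf2 hx hy hϖ2 hxf hyf
  -- `g := xy + ϖu ∈ 𝔪 ∖ (𝔪² + (f))`
  have hg : x * y + ϖ * u ∈ maximalIdeal R :=
    Ideal.add_mem _ (Ideal.mul_mem_right y _ hx) (Ideal.mul_mem_right u _ hϖ)
  have hg2 : x * y + ϖ * u ∉ maximalIdeal R ^ 2 ⊔ Ideal.span {f} := by
    intro hg2
    have hxy : x * y ∈ maximalIdeal R ^ 2 ⊔ Ideal.span {f} :=
      Ideal.mem_sup_left (by rw [pow_two]; exact Ideal.mul_mem_mul hx hy)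
    have hϖu : ϖ * u ∈ maximalIdeal R ^ 2 ⊔ Ideal.span {f} := by
      simpa using Ideal.sub_mem _ hg2 hxy
    obtain ⟨v, hv⟩ := hu.exists_right_inv
    have : ϖ = ϖ * u * v := by rw [mul_assoc, hv, mul_one]
    exact hϖ2 (this ▸ Ideal.mul_mem_right v _ hϖu)
  obtain ⟨hreg, hdim⟩ := isRegularLocalRing_quotient_span_pair hf hf2 hg hg2
  exact ⟨hreg, hdim, not_mem_span_pair_linkedNode u hf hf2 hϖ hϖ2 hx hxf hyf⟩

end Summit.ResolutionOfSingularities.ResolutionOfSingularities.Cruxes.EquisingularLift.StrataSplit
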